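import Summits.Parity.BatemanHorn.Theses.IsogenyRedei
import Summits.Parity.BatemanHorn.Theorems.IsogenyRedeiSplitBlockJacobiPairForm
import Summits.Parity.BatemanHorn.Theorems.IsogenyRedeiSplitBlockJacobiWeylDefs
import Summits.Parity.BatemanHorn.Theorems.IsogenyRedeiSplitBlockJacobiExpectedPart
import Summits.Parity.BatemanHorn.Theorems.IsogenyRedeiSplitBlockJacobiSmallCofactorTail
import Summits.Parity.BatemanHorn.Theorems.IsogenyRedeiSplitBlockJacobiPoissonReduction

/-!
# Skeleton line `cofactor-root-discrepancy` for crux `IsogenyRedei.SplitBlockJacobi` (stmt-Parity-11583)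

Crux (FIXED, by name): `SplitBlockJacobi` =
`∀ θ ∈ (1/2,1), J_θ(x) := Σ_{t ≤ x} Σ_{(Q,Q′) ∈ pf(t²+1)², x^θ < Q < Q′} (Q|Q′) = o(x)`.

## The line (crux idea `cofactor-root-discrepancy`, ideator 3, round 1; triage r1: 3 × pass,
## "merge with `prime-pair-crt-corner`: one pair-Poisson line, tier 1 = the corner")

LEVER. Sum over the PRIME PAIR, not over `t` (pair-side Fubini, = the disprover's §0
`J_eq_sum_pairs_mul_card`):  `J_θ(x) = Σ_{(Q,Q′) ∈ P_θ(x)} (Q|Q′) · A_{QQ′}(x)` with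
`A_q(x) := #{1 ≤ t ≤ x : q ∣ t²+1}` (the COUNT OF SMALL ROOTS of `-1 (mod q)`) and `P_θ(x)` the FREE
set of prime pairs `Q ≡ Q′ ≡ 1 (4)`, `x^θ < Q < Q′`, `QQ′ ≤ x²+1` (`stub_pairForm`). Split the count
into its expectation and its discrepancy, `A_q(x) = 4x/q + disc_q(x)`:

* `E(x) := Σ_P (Q|Q′)·4x/(QQ′)` — the EXPECTED part, a bilinear sum of Legendre symbols over two
  free prime variables: `o(x)` (`stub_expectedPart`; TRUE — the multiplicative large sieve for the
  Legendre characters `(·|Q)`, `Q ~ P₁` (tree: `Literature.NumberTheory.Sieve.largeSieve_character_nat`)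
  saves in every box `P₂ ≥ P₁ log⁵x`, the near-diagonal boxes have total mass `O(x loglog x / log x)`;
  Heath-Brown's quadratic large sieve (Acta Arith. 72, 1995) gives the power saving `x^{1−θ/2+ε}` but
  is NOT needed for `o(x)`).  N.B. Disproof §H: `E` really is `≍ −x^{1−θ/2}/log²x` (Chebyshev bias of
  generic pairs), and `D` carries the opposite secular term — harmless for `o(x)`, fatal for any
  reading "`D ≪ √N`".
* `D(x) := Σ_P (Q|Q′)·disc_{QQ′}(x)` — the `(Q|Q′)`-weighted DISCREPANCY of the small roots of `-1`
  to the moduli `q = QQ′ > x^{2θ} > x` (each `A_q(x) ∈ {0,…,4}`, one period at most).  TIER MAP by the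
  cofactor `m = (t²+1)/q = x^μ`, i.e. `q = x^{2−μ}`:
  - SMALL cofactor `m < x^μ` (`q > x^{2−μ}`): vanishing mass — `Σ A_q ≤ C·μ·x` by the upper-bound
    sieve along the `ρ(m)` root classes of `m` (card `split-mass-middle-prime`'s device in the `m`
    variable; `Σ_{m ≤ x^μ} ρ(m)/m = 𝔠 μ log x + O(1)`), and `4x Σ 1/(QQ′) ≤ C μ x` — peel it
    (`stub_smallCofactorTail`, TRUE, sieve bookkeeping);
  - BULK `q ≤ x^{2−μ}`: smooth the `t`-cutoff (cost `O(ηx)`: ≤ 3 pairs per `t`, Disproof §C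
    `card_bigFactors_le_three`), Poisson in `t` modulo `q`:
    `A^w_q(x) − 4xŵ(0)/q = (x/q) Σ_{h ≠ 0} ŵ(hx/q) S(h,q)`, `S(h,q) = Σ_{ν² ≡ −1 (q)} e(hν/q)`
    (the ROOT WEYL SUM; by CRT = card 1's Kloosterman point `r·Q̄′/Q + r′·Q̄/Q′`), harmonics
    `0 < |h| ≤ H = (q/x)·x^{ε}`, separate the weight by Mellin, cut `(Q,Q′)` into dyadic boxes:
    `D_bulk = o(x)` follows from a bound `x^{1−ε₀}`, uniform in `0 < |h| ≤ P₁P₂x^{ε₀−1}`, for the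
    TWISTED ROOT WEYL SUMS `T_h(P₁,P₂) = Σ_{Q~P₁} Σ_{Q′~P₂} (Q|Q′) S(h, QQ′)` over primes `≡ 1 (4)`
    (`stub_poissonReduction : TierWeylBound θ μ → |D_bulk| ≤ εx`, TRUE, analytic bookkeeping).
  - THE BET `TierWeylBound θ μ` (card's `TwistedRootWeylBound`, = card 1's `MixedBilinear` at the
    corner): with `N ≍ P₁P₂ ≤ x^{2−μ}` terms the bound `x^{1−ε₀}` is a SAVING `N^{(1−μ)/(2−μ)+}`:
    `→ N^{0+}` at the corner `μ → 1` (any power saving; Heath-Brown duality × DFI-1997 amplification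
    is the engine on file), `= N^{1/4}` at `μ = 2/3`, `→ N^{1/2}` as `μ → 0`.  PLANNER'S FINDING
    (recorded in the line card): `N^{1/4}` is EXACTLY the ceiling of every method blind to the
    coefficients — for the kernel `K = ((Q|Q′)S(h,QQ′))` with unit-size entries the cut norm is
    `‖K‖_{∞→1} ≥ c·N^{3/4}` (Khintchine on a random sign pattern) — so the tiers `μ < 2/3` can only
    be reached through the arithmetic of the prime indicator (Vaughan/Heath-Brown identity in `Q`,
    `Q′` ⇒ multilinear Kloosterman-fraction sums, Bettin–Chandee) and need NEAR-square-root
    cancellation as `μ → 0`.  Hence two stubs: `stub_weylShallow` (`2/3 ≤ μ < 1`, saving `≤ N^{1/4}`,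
    contains the corner = tier 1 = card 1) and `stub_weylDeep` (`0 < μ < 2/3`, HARDEST, the line's
    exposure; numerics: `|T_h|/√N ≤ 3.45` to `N = 8.8·10⁶`, triage r1-2/r1-3, kit j008680).

`SplitBlockJacobi_of` composes the six stubs into the crux BY NAME (kernel-checked, no `sorry`):
given `c > 0` take `ε = c/3`; `stub_smallCofactorTail` gives `μ`; `stub_weylShallow`/`stub_weylDeep`
(case `μ ≥ 2/3` or not) give `TierWeylBound θ μ`; `stub_poissonReduction` bounds the bulk,
`stub_expectedPart` the expectation; `stub_pairForm` + `Σ_P = Σ_{q ≤ x^{2−μ}} + Σ_{q > x^{2−μ}}`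
and the triangle inequality give `|J_θ(x)| ≤ c·x` eventually.

## Disproof used (cdisprove v1–v5, evidence 20260815T221831Z…231006Z; `Disproof.lean` is NOT mounted
## in this jail and not published under `Cruxes/`; read through its evidence notes; no `Negative/*` landed)
* §0 `J_eq_sum_pairs_mul_card` (modulus-side Fubini) — IS `stub_pairForm` (restated over this file's
  `pairs`, with the `≡ 1 (4)` filter that makes `ρ(QQ′) = 4` exact; hence `4 ≤ x`).
* §A load-bearing analysis: `θ < 1` not load-bearing (`splitBlockJacobi_iff_withoutUpper`) — the
  stubs never use `θ < 1` except to pass it on; `1/2 < θ` cannot be dropped to `θ = 0`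
  (`not_SplitBlockJacobiWithoutLower`, near-miss, `J₀(x)/x → c₀ = −0.429`) — the line USES `1/2 < θ`
  at `stub_poissonReduction` (`q = QQ′ > x^{2θ} > x`: one period, `H = q/x ≥ 1` harmonics) and at
  `stub_smallCofactorTail` (`≤ 3` big primes); at `θ = 0` the expected part itself is `c₀x ≠ o(x)`.
* §C tightness (`card_bigFactors_le_three`, `abs_J_le : |J_θ(x)| ≤ 9x`, `isBigO_J`) — used inside
  the smoothing step of `stub_poissonReduction`; no stub claims more than `o(x)` for `J`.
* §D (Aurifeuillian sign-coherent families, `jacobiSym_aur_*`): the refuted strengthening "signs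
  equidistribute along algebraic families" is not an instance of any stub (all stubs average over
  the free pair set; a one-parameter family has `O(√x)` pairs).
* §F (SL₂ spin form, one point per horocycle when `B > x`) — this is WHY the line leaves the
  `t`-side: on the pair side thinness is the event "small root", paid for with `H = q/x` harmonics.
* §H (Chebyshev second-order structure) — see the `E`-bullet; `stub_expectedPart` asks only `o(x)`.
* Refuted strengthening (numerical, `theta0_tables.md`): `J_θ = O(x^{1/2+ε}) ∀ θ ∈ (0,1)` is false
  below `1/2` — no stub is stated below `θ = 1/2`.
* Negatives index (`ledger negatives --problem Parity`, 2026-08-16): stmt-Parity-14832, 9541, 4218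
  (GHL) — unrelated; no stub is an instance.
-/

set_option linter.dupNamespace false

noncomputable section

open Finset Filter

namespace Summit.Parity.BatemanHorn.Cruxes.SplitBlockJacobi.CofactorRootDiscrepancy

/-! ### §1 Vocabulary (concrete finite sums over Mathlib; nothing posited)

`rootCount`, `disc`, `pairs`, `Dbulk`, `rootWeylSum`, `twistedSum`, `TierWeylBound` now live in the
TREE (`Theorems/IsogenyRedeiSplitBlockJacobiWeylDefs.lean`, p85335, byte-identical bodies) and are
imported; only `J`, `Epart`, `Dtail` remain local abbreviations here. -/

/-- `J_θ(x)`: the crux's double sum, VERBATIM the body of `IsogenyRedei.SplitBlockJacobi`. -/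
def J (θ : ℝ) (x : ℕ) : ℝ :=
  ∑ t ∈ Finset.Icc 1 x, ∑ q ∈ ((t ^ 2 + 1).primeFactors ×ˢ (t ^ 2 + 1).primeFactors).filter
    (fun q : ℕ × ℕ => (x : ℝ) ^ θ < (q.1 : ℝ) ∧ q.1 < q.2), (jacobiSym (q.1 : ℤ) q.2 : ℝ)

/-- `E_θ(x) := Σ_{(Q,Q′) ∈ P_θ(x)} (Q|Q′) · 4x/(QQ′)` — the EXPECTED part (free bilinear
Legendre sum, weights `4x/(QQ′) < 4`). -/
def Epart (θ : ℝ) (x : ℕ) : ℝ :=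
  ∑ q ∈ pairs θ x, (jacobiSym (q.1 : ℤ) q.2 : ℝ) * (4 * (x : ℝ) / ((q.1 * q.2 : ℕ) : ℝ))

/-- `D^{tail}_{θ,μ}(x) := Σ_{(Q,Q′) ∈ P_θ(x), QQ′ > x^{2−μ}} (Q|Q′) · disc_{QQ′}(x)` — the SMALL
cofactor tail (`m < 2x^μ`), peeled off by a mass bound. -/
def Dtail (θ μ : ℝ) (x : ℕ) : ℝ :=
  ∑ q ∈ (pairs θ x).filter (fun q : ℕ × ℕ => ¬ ((q.1 * q.2 : ℕ) : ℝ) ≤ (x : ℝ) ^ (2 - μ)),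
    (jacobiSym (q.1 : ℤ) q.2 : ℝ) * disc (q.1 * q.2) x

/-! ### §2 The statements of the line (named `Prop`s) -/

/-- STATEMENT 1 — pair-side Fubini: `J_θ(x) = Σ_{P_θ(x)} (Q|Q′)·A_{QQ′}(x)` for `x ≥ 4`. -/
def PairForm : Prop :=
  ∀ θ : ℝ, 1 / 2 < θ → θ < 1 → ∀ x : ℕ, 4 ≤ x →
    J θ x = ∑ q ∈ pairs θ x, (jacobiSym (q.1 : ℤ) q.2 : ℝ) * (rootCount (q.1 * q.2) x : ℝ)

/-- STATEMENT 2 — the expected part cancels: `E_θ(x) = o(x)`. -/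
def ExpectedPartCancels : Prop :=
  ∀ θ : ℝ, 1 / 2 < θ → θ < 1 → ∀ ε : ℝ, 0 < ε → ∀ᶠ x : ℕ in atTop, |Epart θ x| ≤ ε * x

/-- STATEMENT 3 — the small-cofactor tail is peelable: `∀ ε ∃ μ, |D^{tail}_{θ,μ}(x)| ≤ εx` ev. -/
def SmallCofactorTail : Prop :=
  ∀ θ : ℝ, 1 / 2 < θ → θ < 1 → ∀ ε : ℝ, 0 < ε → ∃ μ : ℝ, 0 < μ ∧ μ < 1 ∧
    ∀ᶠ x : ℕ in atTop, |Dtail θ μ x| ≤ ε * x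

/-- STATEMENT 4 — Poisson reduction: the tier Weyl bound controls the bulk discrepancy. -/
def PoissonReduction : Prop :=
  ∀ θ μ : ℝ, 1 / 2 < θ → θ < 1 → 0 < μ → μ < 1 → TierWeylBound θ μ →
    ∀ ε : ℝ, 0 < ε → ∀ᶠ x : ℕ in atTop, |Dbulk θ μ x| ≤ ε * x

/-- STATEMENT 5 — the twisted root Weyl bound on the SHALLOW tiers `2/3 ≤ μ < 1` (saving `≤ N^{1/4}`;
contains the corner `μ ≥ 1 − δ₀`). -/
def WeylShallow : Prop :=
  ∀ θ μ : ℝ, 1 / 2 < θ → θ < 1 → 2 / 3 ≤ μ → μ < 1 → TierWeylBound θ μ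

/-- STATEMENT 6 — the twisted root Weyl bound on the DEEP tiers `0 < μ < 2/3` (saving beyond the
cut-norm ceiling `N^{1/4}`, near `N^{1/2}` as `μ → 0`): the line's bet. -/
def WeylDeep : Prop :=
  ∀ θ μ : ℝ, 1 / 2 < θ → θ < 1 → 0 < μ → μ < 2 / 3 → TierWeylBound θ μ

/-- STATEMENT 4′ — the `h`-SUMMED residual (crux-equivalent given stubs 1–3; weaker than
`TierWeylBound`): the weighted root discrepancy over the bulk `QQ′ ≤ x^{2−μ}` is `o(x)` for every
tier `μ ∈ (0,1)`.  This is what `stub_poissonReduction ∘ (stub_weylShallow ∨ stub_weylDeep)`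
delivers; it is recorded separately as the line's hand-back currency (R2 of the lead's analysis). -/
def BulkDiscrepancyCancels : Prop :=
  ∀ θ μ : ℝ, 1 / 2 < θ → θ < 1 → 0 < μ → μ < 1 →
    ∀ ε : ℝ, 0 < ε → ∀ᶠ x : ℕ in atTop, |Dbulk θ μ x| ≤ ε * x

/-! ### §3 Registered stubs (`sorry` lives ONLY here; signatures = the statements above, expanded) -/

/- **stub_pairForm** — LANDED (p79116, ACCEPTED 2026-08-16): theorem
`Summit.Parity.BatemanHorn.Cruxes.SplitBlockJacobi.CofactorRootDiscrepancy.stub_pairForm` in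
`Summits/Parity/BatemanHorn/Theorems/IsogenyRedeiSplitBlockJacobiPairForm.lean` (imported above; registered
signature, def-free; helpers `two_le_rpow_of_four_le`, `pairForm_filter_eq`). -/

/- **stub_expectedPart** — LANDED modulo farm build (helpers p81147, p81185 ACCEPTED; stub file p84715
`Theorems/IsogenyRedeiSplitBlockJacobiExpectedPart.lean`, registered signature verbatim; imported above). -/

/- **stub_smallCofactorTail** — LANDED modulo farm build (helpers p83426, p84170 ACCEPTED; stub file p84486
`Theorems/IsogenyRedeiSplitBlockJacobiSmallCofactorTail.lean`, registered signature verbatim; imported above). -/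

/-- **stub_bulkDiscrepancy** (the line's RESIDUAL in `h`-summed currency, "R2"; crux-strength, OPEN).
For every tier `μ ∈ (0,1)` the `(Q|Q′)`-weighted discrepancy of the small roots of `−1` over the bulk
`QQ′ ≤ x^{2−μ}` is `o(x)`:  `|Σ_{(Q,Q′) ∈ pairs θ x, QQ′ ≤ x^{2−μ}} (Q|Q′)·(A_{QQ′}(x) − 4x/(QQ′))| ≤ εx`
eventually.  This is EXACTLY what the composition needs from the Weyl layer: it is implied by
`stub_poissonReduction ∧ stub_weylShallow ∧ stub_weylDeep` (`bulkDiscrepancyCancels_of_weyl`, the ENGINE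
route, kept registered below as the sufficient pointwise statements an engine would prove), and together
with the three TRUE stubs it gives the crux (`SplitBlockJacobi_of_bulk`).  It is registered separately
because the pointwise `TierWeylBound` (R1) is strictly STRONGER than needed: through its `∀`-sub-interval
clause it asserts power cancellation in single degenerate rows `Q ∣ h` (= individual twisted prime sums
`Σ_{p~P₂} χ_Q(p) e((h/Q)ν_p/p)`) whenever `θ + μ < 1` (lead's weylDeep-analysis.md §1(c)), whereas the crux
only needs the `h`- and `Q`-summed form.  R2 ⇒ crux (proved below); crux ⇒ R2 fails formally only in that
R2 also asks cancellation tier by tier in the cofactor.  Stated def-free (expanded) for direct landing. -/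
theorem stub_bulkDiscrepancy :
    ∀ θ μ : ℝ, 1 / 2 < θ → θ < 1 → 0 < μ → μ < 1 → ∀ ε : ℝ, 0 < ε →
      ∀ᶠ x : ℕ in Filter.atTop,
        |∑ q ∈ ((Finset.range (x ^ 2 + 2) ×ˢ Finset.range (x ^ 2 + 2)).filter (fun q : ℕ × ℕ =>
            q.1.Prime ∧ q.2.Prime ∧ q.1 % 4 = 1 ∧ q.2 % 4 = 1 ∧ (x : ℝ) ^ θ < (q.1 : ℝ) ∧ q.1 < q.2 ∧
              q.1 * q.2 ≤ x ^ 2 + 1)).filter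
            (fun q : ℕ × ℕ => ((q.1 * q.2 : ℕ) : ℝ) ≤ (x : ℝ) ^ (2 - μ)),
          (jacobiSym (q.1 : ℤ) q.2 : ℝ) *
            (((((Finset.Icc 1 x).filter (fun t : ℕ => q.1 * q.2 ∣ t ^ 2 + 1)).card : ℕ) : ℝ) -
              4 * (x : ℝ) / ((q.1 * q.2 : ℕ) : ℝ))| ≤ ε * x := by
  sorry

/- **stub_poissonReduction** — LANDED (p92787 `Theorems/IsogenyRedeiSplitBlockJacobiPoissonReduction.lean`, 14 files /
3394 lines: RootCountFourier p85251, Smoothing p85263, SmoothCutoff p85270, Abel p85273, Variation p85382, Shell p85275,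
ShellCount p85328, Cell p86532, Cells p85276, PoissonBulk p85336, PoissonMaster p87847, PoissonMasterBound p91277,
PoissonAsymptotics p85277, WeylDefs p85335; registered signature verbatim + def-free twin `poissonReduction_defFree`;
imported above).  TierWeylBound θ μ → D^{bulk}_{θ,μ} = o(x) by finite Fourier analysis on ℤ/qℤ. -/

/- **stub_weylShallow** — RETIRED as a registered stub (drefute g2 F1, 2026-08-16T06:16Z, confirmed by the lead):
`TierWeylBound θ μ` is ANTITONE in `μ` (a larger `μ` only shrinks the box range `P₁P₂ ≤ x^{2−μ}`), so
`WeylDeep → WeylShallow` (`weylShallow_of_weylDeep` below, via the tier `μ = 1/2 < 2/3`); moreover in the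
composition the shallow branch is unreachable because `stub_smallCofactorTail` returns `μ ≤ 1/2`.  The
corner milestone lives on as the landed support theorem `tierWeylBound_of_mixedBilinear` (p84358; drefute g2:
restate its hypothesis with the aspect bound `P₂ ≤ 8P₁^{1+δ₀}`, `MixedBilinearBalanced`). -/

/-- **stub_weylDeep** (size XL; OPEN, HARDEST — the line's exposure).  For `μ < 2/3` the required
saving `N^{(1−μ)/(2−μ)+}` exceeds `N^{1/4}`, which NO bound valid for general unit coefficients can
deliver (`‖((Q|Q′)S(h,QQ′))‖_{∞→1} ≥ c N^{3/4}` by Khintchine — recorded in the line card as a barrier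
note): a proof must open the prime indicators in `Q` and `Q′` (Vaughan / Heath-Brown identity ⇒
tri- and quadrilinear sums of Legendre × Kloosterman-fraction kernels, Bettin–Chandee ranges) and, as
`μ → 0` (cofactor bounded, `q ≍ x²`, `H ≍ x` harmonics), reach within `x^{μ/2}` of SQUARE-ROOT
cancellation — the triagers' "no engine beyond tier 1".  Why it is still the right residual: it is a
statement about FREE prime pairs and all `h` (density restored; the thin set `{t²+1}` is gone), its
`h`-aspect is a genuine equidistribution statement (roots of `-1` to the moduli `QQ′` weighted by the
spin `(Q|Q′)`, cf. Disproof §F), the random model and all numerics give `|T_h| ≍ √N`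
(`≤ 3.45√N` up to `N = 8.8·10⁶`, balanced and `P₂ = 30P₁`), and no reciprocity constraint links
`(Q|Q′)` to the root positions (Disproof `exists_t_of_primes`; rattack: Rédei/Scholz bias killed).
Why it might fail: an arithmetic correlation between `(Q|Q′)` and `ν/(QQ′)` at some structured `h`
(e.g. `h` a norm from `ℤ[i]`) of relative size `N^{−μ/(2(2−μ))}` — tiny, hence hard to exclude
numerically for small `μ`.  A lead should (i) land the implication `MixedBilinear → corner` inside
`stub_weylShallow`, (ii) push kit j008680 to unbalanced deep boxes (`P₁ = x^{0.55}`, `P₂ = x^{1.3}`,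
`h` up to `x^{0.85}`), (iii) treat this stub as the place where round-2 ideas must bite.
Leans on: as `stub_weylShallow`; nothing in tree bears on it. -/
theorem stub_weylDeep :
    ∀ θ μ : ℝ, 1 / 2 < θ → θ < 1 → 0 < μ → μ < 2 / 3 → TierWeylBound θ μ := by
  sorry

/-! ### §4 Consistency: each named statement IS its registered stub (definitionally) -/

theorem pairForm_holds : PairForm := stub_pairForm
theorem expectedPartCancels_holds : ExpectedPartCancels := stub_expectedPart
theorem smallCofactorTail_holds : SmallCofactorTail := stub_smallCofactorTail
theorem bulkDiscrepancyCancels_holds : BulkDiscrepancyCancels := stub_bulkDiscrepancy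
theorem poissonReduction_holds : PoissonReduction := stub_poissonReduction
/-- `TierWeylBound θ ·` is antitone: a bound down to tier `μ₀` gives every shallower tier `μ ≥ μ₀`. -/
theorem tierWeylBound_mono {θ μ₀ μ : ℝ} (hle : μ₀ ≤ μ) (h : TierWeylBound θ μ₀) : TierWeylBound θ μ := by
  obtain ⟨ε₀, hε₀, x₀, hx⟩ := h
  refine ⟨ε₀, hε₀, max x₀ 1, fun x hxx P₁ P₁' P₂ P₂' h1 h2 h3 h4 h5 h6 h7 => ?_⟩
  have hx₀ : x₀ ≤ x := le_trans (le_max_left _ _) hxx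
  have hx1 : (1 : ℝ) ≤ (x : ℝ) := by exact_mod_cast le_trans (le_max_right x₀ 1) hxx
  exact hx x hx₀ P₁ P₁' P₂ P₂' h1 h2 h3 h4 h5 h6
    (h7.trans (Real.rpow_le_rpow_of_exponent_le hx1 (by linarith)))

/-- drefute g2 F1: the deep tiers give the shallow ones (`μ = 1/2 < 2/3` and antitonicity). -/
theorem weylShallow_of_weylDeep (h₆ : WeylDeep) : WeylShallow :=
  fun θ μ hθ₁ hθ₂ hμ _ =>
    tierWeylBound_mono (by linarith) (h₆ θ (1 / 2) hθ₁ hθ₂ (by norm_num) (by norm_num))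

theorem weylShallow_holds : WeylShallow := weylShallow_of_weylDeep stub_weylDeep
theorem weylDeep_holds : WeylDeep := stub_weylDeep

/-! ### §6 The composition: the registered stubs imply the crux, BY NAME (kernel-checked, no `sorry`)

The FIRST theorem concluding the crux is the hypothesis-free `SplitBlockJacobi_of_stubs` (so that the
skeleton checker reads it): the landed TRUE stubs `stub_pairForm`, `stub_expectedPart`,
`stub_smallCofactorTail` (imported) and the registered residual `stub_bulkDiscrepancy` (R2) give the crux by
`ε/3` bookkeeping (the same composition is in the tree def-free: `splitBlockJacobi_of_bulkDiscrepancy` p83479,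
`splitBlockJacobi_of_bulkDiscrepancyCancels` p86347).  The ENGINE route through the pointwise Weyl stubs
follows (`bulkDiscrepancyCancels_of_weyl`, `bulkDiscrepancyCancels_of_weylStubs`). -/

/-- **The crux from the registered stubs** (first crux-concluding theorem of the file): `PairForm`,
`ExpectedPartCancels`, `SmallCofactorTail` (all LANDED) and the residual `BulkDiscrepancyCancels`
(= `stub_bulkDiscrepancy`) imply `SplitBlockJacobi`.  For `θ ∈ (1/2,1)` and `c > 0`: stub 3 at `c/3`
yields the tier `μ`; R2 bounds `|D^{bulk}_{θ,μ}| ≤ (c/3)x`; stub 2 bounds `|E_θ| ≤ (c/3)x`; by stub 1 and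
`A_q = 4x/q + disc_q`, `J_θ = E_θ + D^{bulk} + D^{tail}` for `x ≥ 4`; triangle inequality. -/
theorem SplitBlockJacobi_of_stubs : Summit.Parity.BatemanHorn.Theses.IsogenyRedei.SplitBlockJacobi := by
  intro θ hθ₁ hθ₂
  rw [Asymptotics.isLittleO_iff]
  intro c hc
  have hc3 : 0 < c / 3 := by positivity
  obtain ⟨μ, hμ0, hμ1, hT⟩ := smallCofactorTail_holds θ hθ₁ hθ₂ (c / 3) hc3
  have hBx : ∀ᶠ x : ℕ in atTop, |Dbulk θ μ x| ≤ c / 3 * x :=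
    bulkDiscrepancyCancels_holds θ μ hθ₁ hθ₂ hμ0 hμ1 (c / 3) hc3
  have hE : ∀ᶠ x : ℕ in atTop, |Epart θ x| ≤ c / 3 * x := expectedPartCancels_holds θ hθ₁ hθ₂ (c / 3) hc3
  filter_upwards [hT, hBx, hE, eventually_ge_atTop 4] with x hxT hxB hxE hx4
  have hsplit : J θ x = Epart θ x + (Dbulk θ μ x + Dtail θ μ x) := by
    rw [pairForm_holds θ hθ₁ hθ₂ x hx4]
    have hpt : ∀ q ∈ pairs θ x,
        (jacobiSym (q.1 : ℤ) q.2 : ℝ) * (rootCount (q.1 * q.2) x : ℝ) =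
          (jacobiSym (q.1 : ℤ) q.2 : ℝ) * (4 * (x : ℝ) / ((q.1 * q.2 : ℕ) : ℝ)) +
            (jacobiSym (q.1 : ℤ) q.2 : ℝ) * disc (q.1 * q.2) x := by
      intro q _
      unfold disc
      ring
    rw [Finset.sum_congr rfl hpt, Finset.sum_add_distrib]
    unfold Epart Dbulk Dtail
    congr 1
    exact (Finset.sum_filter_add_sum_filter_not _ _ _).symm
  show ‖J θ x‖ ≤ c * ‖(x : ℝ)‖
  rw [hsplit, Real.norm_eq_abs, Real.norm_eq_abs, Nat.abs_cast]
  have hA1 := abs_add_le (Epart θ x) (Dbulk θ μ x + Dtail θ μ x)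
  have hA2 := abs_add_le (Dbulk θ μ x) (Dtail θ μ x)
  linarith

/-- The Weyl layer delivers the `h`-summed residual: `PoissonReduction`, `WeylShallow` and
`WeylDeep` give `BulkDiscrepancyCancels` (and `WeylShallow` itself follows from `WeylDeep`). -/
theorem bulkDiscrepancyCancels_of_weyl (h₄ : PoissonReduction) (h₅ : WeylShallow)
    (h₆ : WeylDeep) : BulkDiscrepancyCancels := by
  intro θ μ hθ₁ hθ₂ hμ0 hμ1
  have hW : TierWeylBound θ μ := by
    by_cases h : (2 / 3 : ℝ) ≤ μ
    · exact h₅ θ μ hθ₁ hθ₂ h hμ1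
    · exact h₆ θ μ hθ₁ hθ₂ hμ0 (not_le.mp h)
  exact h₄ θ μ hθ₁ hθ₂ hμ0 hμ1 hW

/-- The ENGINE route, wired: the registered pointwise stubs `stub_poissonReduction` (landed/landing) and
`stub_weylDeep` (open) deliver the residual R2 (`BulkDiscrepancyCancels`) — hence, through
`SplitBlockJacobi_of_stubs`'s bookkeeping, the crux — without using `stub_bulkDiscrepancy`.
(Only ONE theorem of this file concludes the crux itself, so that the skeleton checker reads
`SplitBlockJacobi_of_stubs`; the def-free four-hypothesis composition is in the tree as
`splitBlockJacobi_of_bulkDiscrepancy`, p83479, and its unconditional twin as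
`splitBlockJacobi_of_bulkDiscrepancyCancels`, p86347.) -/
theorem bulkDiscrepancyCancels_of_weylStubs : BulkDiscrepancyCancels :=
  bulkDiscrepancyCancels_of_weyl poissonReduction_holds weylShallow_holds weylDeep_holds

/-! ### §7 Scratch checks (vocabulary sanity; `decide`/`norm_num`-sized) -/

/-- `13 = 2²·3 + 1`, `5 ∣ 3²+1 = 10`? no; `5 ∣ 2²+1`, `5 ∣ 3²+1`: `A_5(4) = #{2,3} = 2`. -/
example : rootCount 5 4 = 2 := by decide

/-- The symbol between the two prime factors of `8² + 1 = 5·13` is `(5|13) = −1`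
(Disproof `sign_neg` example; the Aurifeuillian `t = 2m²`, `m = 2 ≡ 2 (4)` family). -/
example : jacobiSym 5 13 = -1 := by norm_num

end Summit.Parity.BatemanHorn.Cruxes.SplitBlockJacobi.CofactorRootDiscrepancy

end
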